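import Summits.QuantumFields.BalabanUV.Beta.SpineRecursiveW
import Summits.QuantumFields.BalabanUV.Beta.SpineRecursiveParity
import Summits.QuantumFields.BalabanUV.Beta.SecondOrderSplitLoc
import Summits.QuantumFields.BalabanUV.Beta.DiagonalContactLoc

/-!
# `BalabanUV.Beta.SpineRecursivePureParity` — binder row D1, the W-side (L4) of the reflection binder hR, leaf (W-SPLIT-TAD):
# the UNFOLDED field tables `SpureRecAt j` of the W-literal are ROW-PARITY-ODD AT EVERY LEVEL, and the staged W-END's residual socket
# (hΔ0) `tadpole G_j (Δ j α μ y ν y′) = 0` — together with its localisation (hΔL) — holds AT THE LITERAL for the displayed residual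
# `Δ j α μ y ν y′ := dM (Ξ_j α ν y′) Lc (SpureRecAt j) (M1At j) μ y`, `Ξ_j α ν y′ := −(G_j ∘ conjV 𝕄_j (diagK (Σ_κ Σ'_u colH G_j Lc ν y′ κ u · γ_j·ctGen)) ∘ G_j)`
# (β sub-cell, D1 formalisation swarm seat `b2b-balaban-beta-d1-formalise-leaf-05`, gen 5; typer-g4 row HR-W-SPLIT-TAD of `beta/formal/D1/LEAVES.md` v10)

HONEST FRAMING (cell contract, verbatim): «discharging `BetaPertH` makes Bałaban's UV stability UNCONDITIONAL — a real
constructive-QFT result; it is NOT the continuum limit and NOT the Clay problem.»  HONEST DEPENDENCY (verbatim): «continuum YM on T⁴ ⇐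
BetaPertH ∧ nine spine estimates (0/9 proved); BetaPertH ⇐ (D1) ∧ (D4) ∧ CAP+tail; G-an2-4 gates asym, D1 and NE2/3/4.»  This module is
[folklore] bookkeeping over tree objects BY NAME (an2's `SpineRecursiveW` (W-D), this lineage's `SpineRecursiveParity` (W-TAD), leaf-10's
`SecondOrderSplitLoc` (HR-W-SPLIT-LOC)); it types no statement of Bałaban's papers, carries no `[cite:]` tag, declares no `def` and no `Prop`
fact, instantiates NO binder of the β-function wall, and is NOT D1, NOT `BetaPertH`, NOT continuum, NOT Clay.  ABSOLUTE RULE (cell, verbatim):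
«No internally-minted statement may enter as a cited fact. Every hypothesis is either kernel-proved in this package or a verbatim quotation of a
PUBLISHED theorem with page reference. The manuscript(s) under audit are NOT citable for their own disputed steps — they are the thing under
adjudication; programme-internal (2001/route/tribunal) claims are never citable.»  Nothing is cited here.

## What is proved (generic `d`, any ODD-OR-NOT `Lc ≥ 1`, ANY in-block root `toSite r`, all coefficients `cE cVH cΛ`, any `γ : ℕ → ℝ`)

* §1 **`trK_SpureRecAt`**: `∀ j κ u, trK (SpureRecAt d Lc (toSite r) cE cVH cΛ j κ u) = −sgnK (…)` — the two displayed members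
  (`SpureRecAt_zero_level`∕`_succ`, `rfl`) are exactly the tables of `SpineRecursiveParity.trK_pureZero`∕`trK_pureSucc`; level `0` for ANY root
  (`trK_SpureRecAt_zero`).  `parityOdd_dM_SpureRecAt_M1At`: the residual shape `dM K′ Lc (SpureRecAt j) (M1At j′) b` is parity-odd for ANY
  weight kernel `K′` (`parityOdd_dM`).
* §2 tadpoles against every step propagator `G_i := coDressKBmAt (toSite r) Lc (KInvStep Lc i)` (spread, sgn-symmetric — `BubbleParity`):
  `tadpole_SpureRecAt_row_eq_zero` ((W-TAD-S) for the unfolded literal, every row, all levels `i j`), `tadpole_vertexOfK_SpureRecAt_eq_zero`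
  (`τ_b = 0` for EVERY coarse bond), **`tadpole_dM_SpureRecAt_M1At_eq_zero`** (the residual shape, ANY `K′`, once localised — the typer's (ii)).
* §3 AT THE LITERAL, binder-free: `decays_locStencil_common` (one common rate for `G_j` and `SpureRecAt j`), **`loc_residual`** = the W-END's
  (hΔL) and **`tadpole_residual_eq_zero`** = the W-END's (hΔ0) for the displayed `Δ` — `K′ := Ξ_j α ν y′` is arbitrary in §2, so NO parity of
  `Ξ` is needed, only its localisation, which is leaf-10's `SecondOrderSplitLoc.loc_dM_Xi_dressed` at the suppliers
  `decays_coDressKBmAt_KInvStep`, `spr_bhKStepAt`, `locStencil_SpureRecAt`, `vertexFamily_M1At`, `locStencil_smul_diagK_ctGen` BY NAME.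
  The binder shapes are those of the staged END `SpineRooted.axisReflectionCovariant_flipK_TbalOf_JsRecWAtOf` (an2-g17, certificate
  a568d991121632ed) read at `d = 3`, `r = ctrOff 4 Lc`: `hΔL := fun j α μ y ν y' => loc_residual …`, `hΔ0 := fun j α μ y ν y' => tadpole_residual_eq_zero …`.

NOT HERE: the letters (hT2)∕(hM2), the split (hsplit) and its other `Loc` sockets (leaf-10), the assembly (W-ASM)∕(W-SPLIT-LIT) (owner an2).
Provenance: b2b-balaban β sub-cell, D1 formalisation swarm leaf-05 gen 5, 2026-08-20 (v1); no existing file touched.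
-/

noncomputable section

open Finset
open scoped BigOperators
open Literature.MathematicalPhysics.QuantumFieldTheory
open Literature.MathematicalPhysics.QuantumFieldTheory.Balaban1983to89
open Literature.MathematicalPhysics.QuantumFieldTheory.Balaban1983to89.Beta
open ExpKernelCalculus (MKer Decays BiLoc VertexFamily comp tadpole)
open AffineAveraging (box toSite)
open OneStepResolventKernel (Fib LocStencil decays_mono)
open OneStepKernelFamily (KInvStep colH vertexOfK)
open BalabanStepJets (locStencil_mono)
open SecondOrderResponse (dM)
open Summit.QuantumFields.BalabanUV.Beta.TameKernelCalculus
open Summit.QuantumFields.BalabanUV.Beta.BorderedHessian (sgnK diagK ctGen cCT bhKStepAt spr_bhKStepAt locStencil_smul_diagK_ctGen)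
open Summit.QuantumFields.BalabanUV.Beta.BubbleParity (spr_of_decays trK_coDressKBmAt_KInvStep)
open Summit.QuantumFields.BalabanUV.Beta.ChartConjugation (conjV)
open Summit.QuantumFields.BalabanUV.Beta.VertexReflectionContact (smul_diagK)
open Summit.QuantumFields.BalabanUV.Beta.VertexSandwichTransport (loc_vertexOfK)
open Summit.QuantumFields.BalabanUV.Beta.AxialDressingRooted (coDressKBmAt decays_coDressKBmAt_KInvStep)
open Summit.QuantumFields.BalabanUV.Beta.KernelWardRemainderParity (trK_vertexOfK_eq_neg_sgnK_of_rows tadpole_vertexOfK_eq_zero_of_rows)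
open Summit.QuantumFields.BalabanUV.Beta.SpineRecursiveParity (trK_pureZero trK_pureSucc trK_M1At parityOdd_dM tadpole_dM_eq_zero_of_rows
  tadpole_stepProp_eq_zero_of_parity loc_of_locStencil)
open Summit.QuantumFields.BalabanUV.Beta.SpineRooted (SpureRecAt SpureRecAt_zero_level SpureRecAt_succ locStencil_SpureRecAt M1At vertexFamily_M1At)
open Summit.QuantumFields.BalabanUV.Beta.SecondOrderSplitLoc (loc_dM_Xi_dressed)

namespace Summit.QuantumFields.BalabanUV.Beta.SpineRecursivePureParity

variable {d : ℕ} {Lc : ℕ} [NeZero Lc]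

/-! ## §1 The unfolded field tables of the W-literal are row-parity-odd at every level -/

section Parity

/-- [folklore] **`SpureRecAt j` IS ROW-PARITY-ODD AT EVERY LEVEL** (in-block root `toSite r`, all coefficients): member `0` =
`cE • wilsonA + cVH • vhSAt ρ` (`SpineRecursiveParity.trK_pureZero`), member `j+1` = `(cE·wE (j+1)) • e3OfK Lc G_j (SrecAt j) + (cVH·wVH (j+1)) • vhSAt ρ`
(`SpineRecursiveParity.trK_pureSucc`, through `trK_SrecAt j`); both members are `rfl`-displayed by an2's `SpureRecAt_zero_level`∕`SpureRecAt_succ`. -/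
theorem trK_SpureRecAt (hLc : 1 ≤ Lc) {r : Fin (d + 1) → ℕ} (hr : r ∈ box (d + 1) Lc) (cE cVH cΛ : ℝ) :
    ∀ (j : ℕ) (κ : Fin (d + 1)) (u : Fin (d + 1) → ℤ),
      trK (SpureRecAt d Lc (toSite r) cE cVH cΛ j κ u) = -sgnK (SpureRecAt d Lc (toSite r) cE cVH cΛ j κ u)
  | 0, κ, u => by
    rw [SpureRecAt_zero_level]
    exact trK_pureZero (toSite r) cE cVH κ u
  | j + 1, κ, u => by
    rw [SpureRecAt_succ]
    exact trK_pureSucc hLc hr cE cVH cΛ j κ u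

omit [NeZero Lc] in
/-- [folklore] Level `0` for ANY root `ρ` (no in-block hypothesis: the native tables `wilsonA`, `vhSAt ρ` are parity-odd for every root). -/
theorem trK_SpureRecAt_zero [NeZero Lc] (ρ : Fin (d + 1) → ℤ) (cE cVH cΛ : ℝ) (κ : Fin (d + 1)) (u : Fin (d + 1) → ℤ) :
    trK (SpureRecAt d Lc ρ cE cVH cΛ 0 κ u) = -sgnK (SpureRecAt d Lc ρ cE cVH cΛ 0 κ u) := by
  rw [SpureRecAt_zero_level]
  exact trK_pureZero ρ cE cVH κ u

/-- [folklore] **THE RESIDUAL SHAPE OVER THE UNFOLDED LITERAL IS PARITY-ODD, FOR ANY WEIGHT KERNEL `K′`**: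
`trK (dM K′ Lc (SpureRecAt … j) (M1At … cΛ′ j′) μ y) = −sgnK (…)` (`SpineRecursiveParity.parityOdd_dM` with §1 and `trK_M1At`). -/
theorem parityOdd_dM_SpureRecAt_M1At (hLc : 1 ≤ Lc) {r : Fin (d + 1) → ℕ} (hr : r ∈ box (d + 1) Lc) (cE cVH cΛ cΛ' : ℝ) (j j' : ℕ)
    (K' : MKer (d + 1) (Fib d)) (μ : Fin (d + 1)) (y : Fin (d + 1) → ℤ) :
    trK (dM K' Lc (SpureRecAt d Lc (toSite r) cE cVH cΛ j) (M1At d Lc (toSite r) cΛ' j') μ y) =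
      -sgnK (dM K' Lc (SpureRecAt d Lc (toSite r) cE cVH cΛ j) (M1At d Lc (toSite r) cΛ' j') μ y) :=
  parityOdd_dM K' Lc (trK_SpureRecAt hLc hr cE cVH cΛ j) (fun ρ w => trK_M1At (toSite r) cΛ' j' ρ w) μ y

end Parity

/-! ## §2 Tadpoles of the unfolded literal against every step propagator -/

section Tadpole

/-- [folklore] **(W-TAD-S) FOR THE UNFOLDED LITERAL**: every row of `SpureRecAt … j` has zero tadpole against every step propagator
`G_i := coDressKBmAt (toSite r) Lc (KInvStep Lc i)` (all levels `i`, `j`; rows are local by an2's `locStencil_SpureRecAt`). -/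
theorem tadpole_SpureRecAt_row_eq_zero (hLc : 1 ≤ Lc) {r : Fin (d + 1) → ℕ} (hr : r ∈ box (d + 1) Lc) (cE cVH cΛ : ℝ) (i j : ℕ)
    (κ : Fin (d + 1)) (u : Fin (d + 1) → ℤ) :
    tadpole (coDressKBmAt (toSite r) Lc (KInvStep (d := d) Lc i)) (SpureRecAt d Lc (toSite r) cE cVH cΛ j κ u) = 0 := by
  obtain ⟨Cs, δs, hδs, hS⟩ := locStencil_SpureRecAt hLc hr cE cVH cΛ j
  exact tadpole_stepProp_eq_zero_of_parity hr i (loc_of_locStencil hS hδs κ u) (trK_SpureRecAt hLc hr cE cVH cΛ j κ u)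

/-- [folklore] **THE ONE-POINT FUNCTION OF THE UNFOLDED LITERAL VANISHES FOR EVERY BOND**: `tadpole G_i (vertexOfK G_j Lc (SpureRecAt … j) μ y) = 0`
for all levels `i`, `j` and ALL coarse bonds `(μ, y)` (an1's `trK_vertexOfK_eq_neg_sgnK_of_rows`, an3's `loc_vertexOfK`). -/
theorem tadpole_vertexOfK_SpureRecAt_eq_zero (hLc : 1 ≤ Lc) {r : Fin (d + 1) → ℕ} (hr : r ∈ box (d + 1) Lc) (cE cVH cΛ : ℝ) (i j : ℕ)
    (μ : Fin (d + 1)) (y : Fin (d + 1) → ℤ) :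
    tadpole (coDressKBmAt (toSite r) Lc (KInvStep (d := d) Lc i))
      (vertexOfK (coDressKBmAt (toSite r) Lc (KInvStep (d := d) Lc j)) Lc (SpureRecAt d Lc (toSite r) cE cVH cΛ j) μ y) = 0 := by
  obtain ⟨Cs, δs, hδs, hS⟩ := locStencil_SpureRecAt hLc hr cE cVH cΛ j
  exact tadpole_stepProp_eq_zero_of_parity hr i
    (loc_vertexOfK (N := Lc) (spr_of_decays (decays_coDressKBmAt_KInvStep hr j)) hS hδs μ y)
    (trK_vertexOfK_eq_neg_sgnK_of_rows _ (trK_SpureRecAt hLc hr cE cVH cΛ j) μ y)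

/-- [folklore] The same at equal levels, in the literal shape of an1's `tadpole_vertexOfK_eq_zero_of_rows`. -/
theorem tadpole_vertexOfK_SpureRecAt_eq_zero' (hLc : 1 ≤ Lc) {r : Fin (d + 1) → ℕ} (hr : r ∈ box (d + 1) Lc) (cE cVH cΛ : ℝ) (j : ℕ)
    (μ : Fin (d + 1)) (y : Fin (d + 1) → ℤ) :
    tadpole (coDressKBmAt (toSite r) Lc (KInvStep (d := d) Lc j))
      (vertexOfK (coDressKBmAt (toSite r) Lc (KInvStep (d := d) Lc j)) Lc (SpureRecAt d Lc (toSite r) cE cVH cΛ j) μ y) = 0 := by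
  obtain ⟨Cs, δs, hδs, hS⟩ := locStencil_SpureRecAt hLc hr cE cVH cΛ j
  exact tadpole_vertexOfK_eq_zero_of_rows (spr_of_decays (decays_coDressKBmAt_KInvStep hr j)) (trK_coDressKBmAt_KInvStep hr j) hS hδs
    (trK_SpureRecAt hLc hr cE cVH cΛ j) μ y

/-- [folklore] **THE RESIDUAL SHAPE OVER THE UNFOLDED LITERAL HAS ZERO TADPOLE** — the typer's (ii) of row HR-W-SPLIT-TAD: against `G_i`, for the
tables `SpureRecAt … j` and `M1At … cΛ′ j′`, ANY weight kernel `K′` (so NO parity of `K′ = Ξ` is needed), any bond, once `dM K′ …` is localised. -/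
theorem tadpole_dM_SpureRecAt_M1At_eq_zero (hLc : 1 ≤ Lc) {r : Fin (d + 1) → ℕ} (hr : r ∈ box (d + 1) Lc) (cE cVH cΛ cΛ' : ℝ)
    (i j j' : ℕ) (K' : MKer (d + 1) (Fib d)) (μ : Fin (d + 1)) (y : Fin (d + 1) → ℤ)
    (hl : Loc (dM K' Lc (SpureRecAt d Lc (toSite r) cE cVH cΛ j) (M1At d Lc (toSite r) cΛ' j') μ y)) :
    tadpole (coDressKBmAt (toSite r) Lc (KInvStep (d := d) Lc i))
      (dM K' Lc (SpureRecAt d Lc (toSite r) cE cVH cΛ j) (M1At d Lc (toSite r) cΛ' j') μ y) = 0 :=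
  tadpole_dM_eq_zero_of_rows (spr_of_decays (decays_coDressKBmAt_KInvStep hr i)) (trK_coDressKBmAt_KInvStep hr i) K' Lc
    (trK_SpureRecAt hLc hr cE cVH cΛ j) (fun ρ w => trK_M1At (toSite r) cΛ' j' ρ w) μ y hl

end Tadpole

/-! ## §3 The staged W-END's (hΔL) and (hΔ0) AT THE LITERAL, binder-free -/

section Literal

/-- [folklore] **ONE COMMON RATE** for the step propagator `G_j` (`decays_coDressKBmAt_KInvStep`) and the unfolded table family `SpureRecAt j`
(`locStencil_SpureRecAt`): shrink both rates to their minimum (`decays_mono`, `locStencil_mono`). -/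
theorem decays_locStencil_common (hLc : 1 ≤ Lc) {r : Fin (d + 1) → ℕ} (hr : r ∈ box (d + 1) Lc) (cE cVH cΛ : ℝ) (j : ℕ) :
    ∃ m C Cs : ℝ, 0 < m ∧ 0 ≤ C ∧ Decays (coDressKBmAt (toSite r) Lc (KInvStep (d := d) Lc j)) C m ∧
      LocStencil (SpureRecAt d Lc (toSite r) cE cVH cΛ j) Cs m := by
  obtain ⟨δG, C, hδG, hC, hG⟩ := decays_coDressKBmAt_KInvStep (d := d) hr j
  obtain ⟨Cs, δs, hδs, hS⟩ := locStencil_SpureRecAt hLc hr cE cVH cΛ j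
  exact ⟨min δG δs, C, Cs, lt_min hδG hδs, hC, decays_mono hG hC le_rfl (min_le_left _ _),
    locStencil_mono hS ((hS 0 0).nonneg (Sum.inl 0)) (min_le_right _ _)⟩

/-- [folklore] The dressed-generator family `κ u ↦ diagK (γ_j · ctGen d α Lc κ u)` is a local stencil family at ANY rate `m ≥ 0`
(`BorderedHessian.locStencil_smul_diagK_ctGen` read through `VertexReflectionContact.smul_diagK`). -/
theorem locStencil_diagK_smul_ctGen (c : ℝ) (α : Fin (d + 1)) {m : ℝ} (hm : 0 ≤ m) :
    LocStencil (fun κ u => diagK fun p a => c * ctGen d α Lc κ u p a) (|c| * cCT d Lc m) m := by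
  have h := locStencil_smul_diagK_ctGen (d := d) α Lc c hm
  simpa only [smul_diagK] using h

/-- [folklore] **(hΔL) AT THE LITERAL**: the displayed residual `Δ j α μ y ν y′ := dM (Ξ_j α ν y′) Lc (SpureRecAt j) (M1At j) μ y`,
`Ξ_j α ν y′ := −(G_j ∘ conjV (bhKStepAt j) (diagK (Σ_κ Σ'_u colH G_j Lc ν y′ κ u · (γ j · ctGen d α Lc κ u))) ∘ G_j)`, is localised — leaf-10's
`SecondOrderSplitLoc.loc_dM_Xi_dressed` at the literal suppliers, every level `j`, axis `α`, bonds `(μ, y)`, `(ν, y′)`, any `γ`. -/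
theorem loc_residual (hLc : 1 ≤ Lc) {r : Fin (d + 1) → ℕ} (hr : r ∈ box (d + 1) Lc) (cE cVH cΛ : ℝ) (γ : ℕ → ℝ) (j : ℕ)
    (α μ : Fin (d + 1)) (y : Fin (d + 1) → ℤ) (ν : Fin (d + 1)) (y' : Fin (d + 1) → ℤ) :
    Loc (dM (-(comp (comp (coDressKBmAt (toSite r) Lc (KInvStep (d := d) Lc j))
        (conjV (bhKStepAt d (toSite r) Lc j)
          (diagK fun p c => ∑ κ, ∑' u, colH (coDressKBmAt (toSite r) Lc (KInvStep (d := d) Lc j)) Lc ν y' κ u * (γ j * ctGen d α Lc κ u p c))))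
        (coDressKBmAt (toSite r) Lc (KInvStep (d := d) Lc j))))
      Lc (SpureRecAt d Lc (toSite r) cE cVH cΛ j) (M1At d Lc (toSite r) cΛ j) μ y) := by
  obtain ⟨m, C, Cs, hm, hC, hG, hS⟩ := decays_locStencil_common hLc hr cE cVH cΛ j
  exact loc_dM_Xi_dressed hG hC hm (spr_bhKStepAt hr j) hS (vertexFamily_M1At hLc hr cΛ j hm.le)
    (locStencil_diagK_smul_ctGen (Lc := Lc) (γ j) α hm.le) μ y ν y'

/-- [folklore] **(hΔ0) AT THE LITERAL — THE RESIDUAL OF THE W-END HAS ZERO TADPOLE AGAINST `G_j`**: for the displayed `Δ j α μ y ν y′`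
(see `loc_residual`), `tadpole G_j (Δ j α μ y ν y′) = 0` at every level `j`, axis `α`, all bonds, any `γ` — §2 with `K′ := Ξ_j α ν y′` (no parity
of `Ξ` used) and (hΔL) from `loc_residual`.  Binder shape = the staged END `SpineRooted.axisReflectionCovariant_flipK_TbalOf_JsRecWAtOf`'s
`hΔ0` at `d = 3`, `r = ctrOff 4 Lc`. -/
theorem tadpole_residual_eq_zero (hLc : 1 ≤ Lc) {r : Fin (d + 1) → ℕ} (hr : r ∈ box (d + 1) Lc) (cE cVH cΛ : ℝ) (γ : ℕ → ℝ) (j : ℕ)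
    (α μ : Fin (d + 1)) (y : Fin (d + 1) → ℤ) (ν : Fin (d + 1)) (y' : Fin (d + 1) → ℤ) :
    tadpole (coDressKBmAt (toSite r) Lc (KInvStep (d := d) Lc j))
      (dM (-(comp (comp (coDressKBmAt (toSite r) Lc (KInvStep (d := d) Lc j))
          (conjV (bhKStepAt d (toSite r) Lc j)
            (diagK fun p c => ∑ κ, ∑' u, colH (coDressKBmAt (toSite r) Lc (KInvStep (d := d) Lc j)) Lc ν y' κ u * (γ j * ctGen d α Lc κ u p c))))
          (coDressKBmAt (toSite r) Lc (KInvStep (d := d) Lc j))))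
        Lc (SpureRecAt d Lc (toSite r) cE cVH cΛ j) (M1At d Lc (toSite r) cΛ j) μ y) = 0 :=
  tadpole_dM_SpureRecAt_M1At_eq_zero hLc hr cE cVH cΛ cΛ j j j _ μ y (loc_residual hLc hr cE cVH cΛ γ j α μ y ν y')

/-- [folklore] The same against a step propagator of ANY level `i` (the END uses `i = j`). -/
theorem tadpole_residual_eq_zero' (hLc : 1 ≤ Lc) {r : Fin (d + 1) → ℕ} (hr : r ∈ box (d + 1) Lc) (cE cVH cΛ : ℝ) (γ : ℕ → ℝ) (i j : ℕ)
    (α μ : Fin (d + 1)) (y : Fin (d + 1) → ℤ) (ν : Fin (d + 1)) (y' : Fin (d + 1) → ℤ) :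
    tadpole (coDressKBmAt (toSite r) Lc (KInvStep (d := d) Lc i))
      (dM (-(comp (comp (coDressKBmAt (toSite r) Lc (KInvStep (d := d) Lc j))
          (conjV (bhKStepAt d (toSite r) Lc j)
            (diagK fun p c => ∑ κ, ∑' u, colH (coDressKBmAt (toSite r) Lc (KInvStep (d := d) Lc j)) Lc ν y' κ u * (γ j * ctGen d α Lc κ u p c))))
          (coDressKBmAt (toSite r) Lc (KInvStep (d := d) Lc j))))
        Lc (SpureRecAt d Lc (toSite r) cE cVH cΛ j) (M1At d Lc (toSite r) cΛ j) μ y) = 0 :=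
  tadpole_dM_SpureRecAt_M1At_eq_zero hLc hr cE cVH cΛ cΛ i j j _ μ y (loc_residual hLc hr cE cVH cΛ γ j α μ y ν y')

end Literal

end Summit.QuantumFields.BalabanUV.Beta.SpineRecursivePureParity

end
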